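import Literature.IUT.LogVolume.SubThetaFieldRamificationFifteen
import Literature.IUT.LogVolume.Corollary22FreyPoint
import Literature.IUT.LogVolume.Corollary22RatPointDictionary
import Literature.NumberTheory.DiophantineGeometry.GenEllMellReduction
import HarnessLib

/-!
# Branch C / R-W lane P−: ORDER data of an abc triple at a prime — the inputs of the PARITY local type `e ∣ 15·l`
# (exact valuations `ord_p(a/c)`, `ord_p(a/c − 1)`; `v_p(abc)` even ⇒ both even; a pole prime of even `λ`-order is MULTIPLICATIVE for
# the Legendre curve over `ℚ`)

PROOF-ONLY file (no `def`, no new `Prop`, no instance) of the abc-iut cell (R-W seat abc-iut-W-ref-1, gen 0; director-abc g3 MINT-LIST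
BATCH 1, row «TARGETS.tsv 043f473bc4159fa7 kind TE rows 1–25»). TAKES NO SIDE on [IUTchIII] Cor. 3.12 or on any author; classical
arithmetic only. These are the hypotheses of abc-iut-w4-d087's parity local-type lemma
`Cor22.ThetaVolumeDatumAt.ramificationIdx_int_dvd_fifteen_mul_ratPoint'` (p463720: Legendre curve MULTIPLICATIVE over `ℚ` at `p`, `ord_p λ` and
`ord_p(λ−1)` EVEN ⇒ `e(u | p) ∣ 15·l`) discharged from ORDER data alone, for use by the sequel `AbcOfSGenuineKTameRobustFifteen`:
* `TameRobust.exists_valuation_eq_exp_two_mul_of_even_ord` — `ord_v x` even ⇒ `|x|_v = exp(2k)`;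
* `TameRobust.legendre_hasMultiplicativeReductionAt_rat_of_even_ord` — `q ∈ ℚ ∖ {0,1}`, `v ∤ 2`, `ord_v j(q) < 0`, `ord_v q` even ⇒
  `y² = x(x−1)(x−q)` is MULTIPLICATIVE at `v` over `ℚ` (Silverman *AEC* VII.5.4 (c): Case 2 by the tree's
  `legendre_hasMultiplicativeReductionAt_of_valuation_lt_one` / `…_sub_one_lt_one`, Case 3 with `u = π^{−m}` by w4-d087's
  `…_of_one_lt_valuation_of_valuation_sq_eq`; `|q|_v = |q−1|_v = 1` is good reduction, `|j|_v ≤ 1`, excluded by the pole);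
* `TameRobust.factorization_eq_of_pow_dvd_of_not_dvd`, `TameRobust.even_factorization_of_isABCTriple`, `TameRobust.ord_ratPoint_triple[_sub_one]`,
  `TameRobust.even_ord_ratPoint_triple` — for an abc triple `a + b = c`: `ord_p(a/c) = v_p(a) − v_p(c)`, `ord_p(a/c − 1) = v_p(b) − v_p(c)`, and
  `p^v ∥ abc` with `v` EVEN ⇒ both even (`p` divides exactly one of `a, b, c`).
[cite: SilvermanAEC2009, proof of Prop. VII.5.4(c) (PDF pp. 176–177) and Prop. VII.5.1(b)] [cite: DupuyHilado2025, §2.4.2]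
[cite: Mochizuki2012, IUTchIV Thm. 1.10 proof Step (iii) (R4) p. 26] [claim: Mochizuki2012, status: disputed] for the one IUT locator quoted.
-/

noncomputable section

open NumberField IsDedekindDomain

namespace Summit.ABC.IUTFork.Conditional

open Literature.IUT.LogVolume Literature.IUT.LogVolume.Cor22
open Literature.NumberTheory.DiophantineGeometry Literature.NumberTheory.DiophantineGeometry.GenEll

/-! ## §1. The exact valuation dictionary of an abc triple at a prime -/

namespace TameRobust

/-- `p^t ∣ n`, `p^{t+1} ∤ n`, `n ≠ 0` ⇒ `v_p(n) = t`. [folklore] -/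
theorem factorization_eq_of_pow_dvd_of_not_dvd {p n t : ℕ} (hp : p.Prime) (hn : n ≠ 0) (h1 : p ^ t ∣ n)
    (h2 : ¬ p ^ (t + 1) ∣ n) : n.factorization p = t := by
  have hle : t ≤ n.factorization p := (hp.pow_dvd_iff_le_factorization hn).1 h1
  have hlt : ¬ t + 1 ≤ n.factorization p := fun h => h2 ((hp.pow_dvd_iff_le_factorization hn).2 h)
  omega

/-- For an abc triple `a + b = c` (coprime) and a prime `p`: if `v_p(abc)` is EVEN then `v_p(a)`, `v_p(b)`, `v_p(c)` are all even
(`p` divides at most one of `a, b, c`, so each of the three is `0` or `v_p(abc)`). [folklore] -/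
theorem even_factorization_of_isABCTriple {a b c p : ℕ} (habc : IsABCTriple a b c) (hp : p.Prime)
    (he : Even ((a * b * c).factorization p)) :
    Even (a.factorization p) ∧ Even (b.factorization p) ∧ Even (c.factorization p) := by
  obtain ⟨ha, hb, hsum, hcop⟩ := habc
  have hc : c ≠ 0 := by omega
  have hac : Nat.Coprime a c := by rw [← hsum, Nat.coprime_self_add_right]; exact hcop
  have hbc : Nat.Coprime b c := by rw [← hsum, add_comm, Nat.coprime_self_add_right]; exact hcop.symm
  rw [Nat.factorization_mul (Nat.mul_ne_zero ha.ne' hb.ne') hc, Nat.factorization_mul ha.ne' hb.ne',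
    Finsupp.add_apply, Finsupp.add_apply] at he
  have key : ∀ {x y : ℕ}, Nat.Coprime x y → x.factorization p = 0 ∨ y.factorization p = 0 := by
    intro x y hxy
    by_cases hx : p ∣ x
    · refine Or.inr (Nat.factorization_eq_zero_of_not_dvd fun hy => ?_)
      exact hp.one_lt.ne' (Nat.eq_one_of_dvd_coprimes hxy hx hy)
    · exact Or.inl (Nat.factorization_eq_zero_of_not_dvd hx)
  simp only [Nat.even_iff] at he ⊢
  rcases key hcop with h₁ | h₁ <;> rcases key hac with h₂ | h₂ <;> rcases key hbc with h₃ | h₃ <;> omega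

/-- `ord_v(−x) = ord_v(x)`. [folklore] -/
theorem ord_neg_eq {F : Type*} [Field F] [NumberField F] (v : HeightOneSpectrum (𝓞 F)) (x : F) :
    ord F v (-x) = ord F v x := by
  unfold ord
  rw [Valuation.map_neg]

/-- **`ord_v(a/c) = v_p(a) − v_p(c)`** at the place `v` of `ℚ` over `p` (`a, c ≠ 0`). [cite: DupuyHilado2025, §2.4.2] -/
theorem ord_ratPoint_triple {a b c : ℕ} (habc : IsABCTriple a b c) (v : HeightOneSpectrum (𝓞 ℚ)) :
    ord ℚ v ((a : ℚ) / c) =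
      (a.factorization (Rat.HeightOneSpectrum.natGenerator v) : ℤ) - c.factorization (Rat.HeightOneSpectrum.natGenerator v) := by
  obtain ⟨ha, hb, hsum, -⟩ := habc
  have hc : c ≠ 0 := by omega
  have ha0 : (a : ℚ) ≠ 0 := by exact_mod_cast ha.ne'
  have hc0 : (c : ℚ) ≠ 0 := by exact_mod_cast hc
  rw [div_eq_mul_inv, ord_mul ℚ v ha0 (inv_ne_zero hc0), ord_inv, ord_natCast_eq_factorization v ha.ne',
    ord_natCast_eq_factorization v hc]
  ring

/-- **`ord_v(a/c − 1) = v_p(b) − v_p(c)`** (`a/c − 1 = −b/c` as `a + b = c`). [cite: DupuyHilado2025, §2.4.2] -/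
theorem ord_ratPoint_triple_sub_one {a b c : ℕ} (habc : IsABCTriple a b c) (v : HeightOneSpectrum (𝓞 ℚ)) :
    ord ℚ v ((a : ℚ) / c - 1) =
      (b.factorization (Rat.HeightOneSpectrum.natGenerator v) : ℤ) - c.factorization (Rat.HeightOneSpectrum.natGenerator v) := by
  obtain ⟨ha, hb, hsum, -⟩ := habc
  have hc : c ≠ 0 := by omega
  have hb0 : (b : ℚ) ≠ 0 := by exact_mod_cast hb.ne'
  have hc0 : (c : ℚ) ≠ 0 := by exact_mod_cast hc
  have hsub : (a : ℚ) / c - 1 = -((b : ℚ) * (c : ℚ)⁻¹) := by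
    have h : (a : ℚ) + b = c := by exact_mod_cast hsum
    field_simp
    linarith
  rw [hsub, ord_neg_eq, ord_mul ℚ v hb0 (inv_ne_zero hc0), ord_inv, ord_natCast_eq_factorization v hb.ne',
    ord_natCast_eq_factorization v hc]
  ring

/-- **Parity of the Legendre parameter of an abc triple**: if `v_p(abc)` is EVEN then `ord_v(a/c)` and `ord_v(a/c − 1)` are even at every
place `v` of `ℚ` over `p` — the «no quadratic twist at `p`» input of the parity local-type lemma (`√λ`, `√(λ−1)` unramified at `p`).
[cite: Mochizuki2012, IUTchIV Thm. 1.10 proof Step (iii) (R4) p. 26] [claim: Mochizuki2012, status: disputed] -/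
theorem even_ord_ratPoint_triple {a b c p : ℕ} (habc : IsABCTriple a b c) (hp : p.Prime)
    (he : Even ((a * b * c).factorization p)) (v : HeightOneSpectrum (𝓞 ℚ)) (hv : Rat.HeightOneSpectrum.natGenerator v = p) :
    Even (ord ℚ v ((a : ℚ) / c)) ∧ Even (ord ℚ v ((a : ℚ) / c - 1)) := by
  obtain ⟨h₁, h₂, h₃⟩ := even_factorization_of_isABCTriple habc hp he
  rw [ord_ratPoint_triple habc, ord_ratPoint_triple_sub_one habc, hv]
  obtain ⟨x, hx⟩ := h₁; obtain ⟨y, hy⟩ := h₂; obtain ⟨z, hz⟩ := h₃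
  exact ⟨⟨(x : ℤ) - z, by rw [hx, hz]; push_cast; ring⟩, ⟨(y : ℤ) - z, by rw [hy, hz]; push_cast; ring⟩⟩

/-- If `x ≠ 0` has EVEN order at `v` then `|x|_v = exp(2k)` for some `k ∈ ℤ` (`|x|_v = exp(−ord_v x)`). [folklore] -/
theorem exists_valuation_eq_exp_two_mul_of_even_ord {F : Type*} [Field F] [NumberField F]
    (v : HeightOneSpectrum (𝓞 F)) {x : F} (hx : x ≠ 0) (h : Even (ord F v x)) :
    ∃ k : ℤ, v.valuation F x = WithZero.exp (2 * k) := by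
  obtain ⟨r, hr⟩ := h
  have hne : v.valuation F x ≠ 0 := by rwa [ne_eq, map_eq_zero]
  refine ⟨-r, ?_⟩
  have hlog : WithZero.log (v.valuation F x) = -ord F v x := by simp [ord]
  rw [← WithZero.exp_log hne, hlog, hr]
  ring_nf

/-- **The Legendre curve over `ℚ` is MULTIPLICATIVE at an odd pole prime of even `λ`-order.** For `q ∈ ℚ ∖ {0, 1}` and a place
`v ∤ 2` of `ℚ` with `ord_v j(q) < 0` and `ord_v q` EVEN, `y² = x(x−1)(x−q)` has multiplicative reduction at `v` over `ℚ` itself: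
if `|q|_v < 1` or `|q − 1|_v < 1` this is Silverman's Case 2 (the tree's `legendre_hasMultiplicativeReductionAt_of_valuation_lt_one` /
`…_sub_one_lt_one`); `|q|_v = |q − 1|_v = 1` would be good reduction (`|j|_v ≤ 1`, contradicting the pole); and `|q|_v = exp(2m) > 1` is Case 3
over `ℚ` with `u = π^{−m}` (abc-iut-w4-d087's `legendre_hasMultiplicativeReductionAt_of_one_lt_valuation_of_valuation_sq_eq`).
[cite: SilvermanAEC2009, proof of Prop. VII.5.4(c) (PDF pp. 176–177) and Prop. VII.5.1(b)] -/
theorem legendre_hasMultiplicativeReductionAt_rat_of_even_ord {q : ℚ} (hq0 : q ≠ 0) (hq1 : q ≠ 1)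
    (v : HeightOneSpectrum (𝓞 ℚ)) (hv2 : Rat.HeightOneSpectrum.natGenerator v ≠ 2)
    (hpole : ord ℚ v (Cor22.jInv q) < 0) (hev : Even (ord ℚ v q)) :
    (⟨0, -(1 + q), 0, q, 0⟩ : WeierstrassCurve ℚ).HasMultiplicativeReductionAt v := by
  have h20 : (2 : ℚ) ≠ 0 := by norm_num
  haveI hE : (⟨0, -(1 + q), 0, q, 0⟩ : WeierstrassCurve ℚ).IsElliptic :=
    (Literature.NumberTheory.EllipticCurves.legendre_isElliptic_iff h20 q).2 ⟨hq0, hq1⟩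
  have h2 : v.valuation ℚ (2 : ℚ) = 1 := by
    have h := (Literature.NumberTheory.DiophantineGeometry.UniformABCConjecture.valuation_natCast_eq_one_iff v 2).2
      (fun h => hv2 ((Nat.prime_dvd_prime_iff_eq (Rat.HeightOneSpectrum.prime_natGenerator v) Nat.prime_two).1 h))
    simpa using h
  rcases lt_trichotomy (v.valuation ℚ q) 1 with hlt | heq | hgt
  · exact Literature.NumberTheory.EllipticCurves.legendre_hasMultiplicativeReductionAt_of_valuation_lt_one v h2 hlt
  · have hle1 : v.valuation ℚ (q - 1) ≤ 1 := Valuation.map_sub_le _ heq.le (by rw [Valuation.map_one])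
    rcases hle1.lt_or_eq with hlt1 | heq1
    · exact Literature.NumberTheory.EllipticCurves.legendre_hasMultiplicativeReductionAt_of_valuation_sub_one_lt_one v h2 hlt1
    · exfalso
      have hgood := Literature.NumberTheory.EllipticCurves.legendre_hasGoodReductionAt_of_valuation_eq_one v h2 heq heq1
      have hle : v.valuation ℚ (⟨0, -(1 + q), 0, q, 0⟩ : WeierstrassCurve ℚ).j ≤ 1 :=
        valuation_j_le_one_of_hasGoodReduction_localMinimalModel v _ hgood
      have hj : (⟨0, -(1 + q), 0, q, 0⟩ : WeierstrassCurve ℚ).j = Cor22.jInv q := @Cor22.j_legendre (ratPoint q) ⟨hq0, hq1⟩ hE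
      rw [hj] at hle
      have hj0 : Cor22.jInv q ≠ 0 := fun h0 => by
        rw [h0, ord_zero] at hpole
        exact lt_irrefl _ hpole
      have hne : v.valuation ℚ (Cor22.jInv q) ≠ 0 := (Valuation.ne_zero_iff _).mpr hj0
      have hlog : WithZero.log (v.valuation ℚ (Cor22.jInv q)) ≤ 0 := by
        rw [WithZero.log_le_iff_le_exp hne]; simpa using hle
      unfold ord at hpole
      omega
  · obtain ⟨m, hm⟩ := exists_valuation_eq_exp_two_mul_of_even_ord v hq0 hev
    obtain ⟨π, hπ⟩ := v.valuation_exists_uniformizer ℚ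
    have hπ0 : π ≠ 0 := by
      intro h
      rw [h, map_zero] at hπ
      exact WithZero.coe_ne_zero hπ.symm
    refine Literature.NumberTheory.EllipticCurves.legendre_hasMultiplicativeReductionAt_of_one_lt_valuation_of_valuation_sq_eq
      v h2 hgt (d := π ^ (-m)) ?_
    rw [map_zpow₀, hπ, hm, ← zpow_natCast, ← zpow_mul, ← WithZero.exp_zsmul]
    congr 1
    simp only [smul_eq_mul]
    push_cast
    ring

end TameRobust

end Summit.ABC.IUTFork.Conditional

end
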